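import Mathlib

/-!
# PercRepro — the bipartition types of an 8-point code and their meet structure (typer-2, gen 5)

Piece (iv)-a of p4's CodeBound8 plan (`proofs/P4-seven.md` §9.1 (i)–(ii)): a code `C` of 4-subsets of a
finite type with a 3-colouring `cl` such that complements are in `C` with a different colour and members of
different colours meet in `≤ 2` points. The **oriented representatives of the bipartition type `(i, j)`** are
`typeRep C cl i j = {σ ∈ C : cl σ = i ∧ cl σᶜ = j}`. Pure finite-set arithmetic, Mathlib only:

* `card_inter_add_card_inter_compl` — `|σ ∩ τ| + |σ ∩ τᶜ| = |σ|`;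
* **`card_inter_eq_two_of_types_ne`** — representatives of DIFFERENT types (as unordered pairs of colours)
  meet in exactly `2` points (§9.1 (i): the relevant cross-intersections are `≤ 2` and sum to `4`);
* **`card_inter_mem_of_type_eq`** — distinct representatives of the SAME type meet in `2` or `3` points
  (§9.1 (ii): `σ` and `τᶜ` have different colours, so `|σ ∩ τᶜ| ≤ 2`, i.e. `|σ ∩ τ| ≥ 2`).

These are exactly the hypotheses of `finrank_span_signVec_add_three_le_seven` (piece (D)) and
`finrank_span_signVec_eq_rank_two_add` (piece (H)) in `SignVec.lean` / `SignRank.lean`. The counting side: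
`image_compl_typeRep`, `card_typeRep_symm`, `card_eq_sum_typeRep` (the six ordered types partition `C`) and
**`card_eq_two_mul_types`** — `|C| = 2·(|X| + |Y| + |Z|)` for the three unordered types.
-/

namespace PercRepro

open Finset

variable {α : Type*} [Fintype α] [DecidableEq α]

/-- `|σ ∩ τ| + |σ ∩ τᶜ| = |σ|`. -/
theorem card_inter_add_card_inter_compl (σ τ : Finset α) :
    (σ ∩ τ).card + (σ ∩ τᶜ).card = σ.card := by
  rw [← Finset.sdiff_eq_inter_compl, Finset.card_inter_add_card_sdiff]

/-- The oriented representatives of the bipartition type `(i, j)`: members of colour `i` whose complement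
has colour `j`. -/
def typeRep (C : Finset (Finset α)) (cl : Finset α → Fin 3) (i j : Fin 3) : Finset (Finset α) :=
  C.filter fun σ => cl σ = i ∧ cl σᶜ = j

/-- Membership in a type. -/
theorem mem_typeRep {C : Finset (Finset α)} {cl : Finset α → Fin 3} {i j : Fin 3} {σ : Finset α} :
    σ ∈ typeRep C cl i j ↔ σ ∈ C ∧ cl σ = i ∧ cl σᶜ = j := by
  simp [typeRep]

/-- The four meet numbers of two 4-sets with 4-set complements: `|σᶜ ∩ τ| = 4 − |σ ∩ τ|`,
`|σ ∩ τᶜ| = 4 − |σ ∩ τ|`, `|σᶜ ∩ τᶜ| = |σ ∩ τ|`. -/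
theorem meet_numbers {σ τ : Finset α} (hσ : σ.card = 4) (hτ : τ.card = 4) (hτc : τᶜ.card = 4) :
    (σ ∩ τᶜ).card + (σ ∩ τ).card = 4 ∧ (σᶜ ∩ τ).card + (σ ∩ τ).card = 4 ∧
      (σᶜ ∩ τᶜ).card = (σ ∩ τ).card := by
  have a := card_inter_add_card_inter_compl σ τ
  have b := card_inter_add_card_inter_compl τ σ
  have c := card_inter_add_card_inter_compl τᶜ σ
  rw [hσ] at a
  rw [hτ, Finset.inter_comm τ σ, Finset.inter_comm τ σᶜ] at b
  rw [hτc, Finset.inter_comm τᶜ σ, Finset.inter_comm τᶜ σᶜ] at c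
  omega

/-- **Representatives of different types meet in exactly two points** (§9.1 (i)): for `σ` of type `(i, j)`
and `τ` of type `(k, l)` with `{i, j} ≠ {k, l}`, `|σ ∩ τ| = 2`. -/
theorem card_inter_eq_two_of_types_ne (C : Finset (Finset α)) (cl : Finset α → Fin 3)
    (h4 : ∀ σ ∈ C, σ.card = 4) (hcompl : ∀ σ ∈ C, σᶜ ∈ C) (hcl : ∀ σ ∈ C, cl σᶜ ≠ cl σ)
    (hne : ∀ σ ∈ C, ∀ τ ∈ C, cl σ ≠ cl τ → (σ ∩ τ).card ≤ 2) {i j k l : Fin 3}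
    (htype : ¬ ((i = k ∧ j = l) ∨ (i = l ∧ j = k))) {σ τ : Finset α}
    (hσ : σ ∈ typeRep C cl i j) (hτ : τ ∈ typeRep C cl k l) : (σ ∩ τ).card = 2 := by
  rw [mem_typeRep] at hσ hτ
  obtain ⟨hσC, hσi, hσj⟩ := hσ
  obtain ⟨hτC, hτk, hτl⟩ := hτ
  have hσcC : σᶜ ∈ C := hcompl σ hσC
  have hτcC : τᶜ ∈ C := hcompl τ hτC
  obtain ⟨m1, m2, m3⟩ := meet_numbers (h4 σ hσC) (h4 τ hτC) (h4 τᶜ hτcC)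
  have hkl : k ≠ l := fun h => hcl τ hτC (by rw [hτl, hτk, h])
  -- the four colour comparisons available
  have u1 : i ≠ k → (σ ∩ τ).card ≤ 2 := fun h => hne σ hσC τ hτC (by rw [hσi, hτk]; exact h)
  have u2 : i ≠ l → (σ ∩ τᶜ).card ≤ 2 := fun h => hne σ hσC τᶜ hτcC (by rw [hσi, hτl]; exact h)
  have u3 : j ≠ k → (σᶜ ∩ τ).card ≤ 2 := fun h => hne σᶜ hσcC τ hτC (by rw [hσj, hτk]; exact h)
  have u4 : j ≠ l → (σᶜ ∩ τᶜ).card ≤ 2 := fun h => hne σᶜ hσcC τᶜ hτcC (by rw [hσj, hτl]; exact h)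
  by_cases hik : i = k
  · subst hik
    have hjl : j ≠ l := fun h => htype (Or.inl ⟨rfl, h⟩)
    have := u2 hkl
    have := u4 hjl
    omega
  · have := u1 hik
    by_cases hil : i = l
    · subst hil
      have hjk : j ≠ k := fun h => htype (Or.inr ⟨rfl, h⟩)
      have := u3 hjk
      omega
    · have := u2 hil
      omega

/-- **Distinct representatives of the same type meet in two or three points** (§9.1 (ii)): for
`σ ≠ τ` both of type `(i, j)`, `|σ ∩ τ| ∈ {2, 3}` (`σ` and `τᶜ` have the different colours `i ≠ j`, so
`|σ ∩ τᶜ| ≤ 2`; and `|σ ∩ τ| = 4` would force `σ = τ`). -/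
theorem card_inter_mem_of_type_eq (C : Finset (Finset α)) (cl : Finset α → Fin 3)
    (h4 : ∀ σ ∈ C, σ.card = 4) (hcompl : ∀ σ ∈ C, σᶜ ∈ C) (hcl : ∀ σ ∈ C, cl σᶜ ≠ cl σ)
    (hne : ∀ σ ∈ C, ∀ τ ∈ C, cl σ ≠ cl τ → (σ ∩ τ).card ≤ 2) {i j : Fin 3} {σ τ : Finset α}
    (hσ : σ ∈ typeRep C cl i j) (hτ : τ ∈ typeRep C cl i j) (hst : σ ≠ τ) :
    (σ ∩ τ).card = 2 ∨ (σ ∩ τ).card = 3 := by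
  rw [mem_typeRep] at hσ hτ
  obtain ⟨hσC, hσi, -⟩ := hσ
  obtain ⟨hτC, hτi, hτj⟩ := hτ
  have hτcC : τᶜ ∈ C := hcompl τ hτC
  obtain ⟨m1, -, -⟩ := meet_numbers (h4 σ hσC) (h4 τ hτC) (h4 τᶜ hτcC)
  have hij : i ≠ j := fun h => hcl τ hτC (by rw [hτj, hτi, h])
  have hlow : (σ ∩ τᶜ).card ≤ 2 := hne σ hσC τᶜ hτcC (by rw [hσi, hτj]; exact hij)
  have hle : (σ ∩ τ).card ≤ σ.card := Finset.card_le_card Finset.inter_subset_left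
  have hne4 : (σ ∩ τ).card ≠ 4 := by
    intro h
    apply hst
    have hsub : σ ⊆ τ :=
      Finset.inter_eq_left.mp
        (Finset.eq_of_subset_of_card_le Finset.inter_subset_left (by rw [h, h4 σ hσC]))
    exact Finset.eq_of_subset_of_card_le hsub (by rw [h4 σ hσC, h4 τ hτC])
  rw [h4 σ hσC] at hle
  omega

/-- Complementation maps the type `(i, j)` onto the type `(j, i)`. -/
theorem image_compl_typeRep (C : Finset (Finset α)) (cl : Finset α → Fin 3) (hcompl : ∀ σ ∈ C, σᶜ ∈ C)
    (i j : Fin 3) : (typeRep C cl i j).image compl = typeRep C cl j i := by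
  ext τ
  simp only [Finset.mem_image, mem_typeRep]
  constructor
  · rintro ⟨σ, ⟨hσC, hσi, hσj⟩, rfl⟩
    exact ⟨hcompl σ hσC, hσj, by rw [compl_compl]; exact hσi⟩
  · rintro ⟨hτC, hτj, hτi⟩
    exact ⟨τᶜ, ⟨hcompl τ hτC, hτi, by rw [compl_compl]; exact hτj⟩, compl_compl τ⟩

/-- The types `(i, j)` and `(j, i)` have the same size. -/
theorem card_typeRep_symm (C : Finset (Finset α)) (cl : Finset α → Fin 3) (hcompl : ∀ σ ∈ C, σᶜ ∈ C)
    (i j : Fin 3) : (typeRep C cl j i).card = (typeRep C cl i j).card := by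
  rw [← image_compl_typeRep C cl hcompl i j, Finset.card_image_of_injective _ compl_injective]

/-- The code is the disjoint union of its six ordered types. -/
theorem card_eq_sum_typeRep (C : Finset (Finset α)) (cl : Finset α → Fin 3) (hcl : ∀ σ ∈ C, cl σᶜ ≠ cl σ) :
    C.card = ∑ p ∈ (Finset.univ.filter fun p : Fin 3 × Fin 3 => p.1 ≠ p.2), (typeRep C cl p.1 p.2).card := by
  rw [Finset.card_eq_sum_card_fiberwise (f := fun σ => (cl σ, cl σᶜ))
    (t := Finset.univ.filter fun p : Fin 3 × Fin 3 => p.1 ≠ p.2)]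
  · refine Finset.sum_congr rfl fun p _ => ?_
    congr 1
    ext σ
    simp only [Finset.mem_filter, typeRep, Prod.ext_iff]
  · intro σ hσ
    exact Finset.mem_filter.mpr ⟨Finset.mem_univ _, fun h => hcl σ hσ (Eq.symm h)⟩

/-- **`|C| = 2·(|X| + |Y| + |Z|)`** for the three unordered types `X = (0,1)`, `Y = (0,2)`, `Z = (1,2)`
(oriented by the smaller colour). -/
theorem card_eq_two_mul_types (C : Finset (Finset α)) (cl : Finset α → Fin 3)
    (hcompl : ∀ σ ∈ C, σᶜ ∈ C) (hcl : ∀ σ ∈ C, cl σᶜ ≠ cl σ) :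
    C.card = 2 * ((typeRep C cl 0 1).card + (typeRep C cl 0 2).card + (typeRep C cl 1 2).card) := by
  rw [card_eq_sum_typeRep C cl hcl, Finset.sum_filter, Fintype.sum_prod_type]
  simp only [Fin.sum_univ_three]
  simp only [ne_eq, not_true_eq_false, if_false, zero_add, add_zero, if_true, Fin.zero_eq_one_iff,
    Fin.one_eq_zero_iff, OfNat.ofNat_ne_one, Fin.reduceEq, not_false_eq_true]
  rw [card_typeRep_symm C cl hcompl 0 1, card_typeRep_symm C cl hcompl 0 2, card_typeRep_symm C cl hcompl 1 2]
  ring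

end PercRepro
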